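import Summits.Ventures.HodgeRepro2.T5QuadraticInertBridge

/-!
# T5QuadraticCensusFinite — the census decides all but FINITELY MANY places

Tier-5 kernel support (seat p8, blind lane; sub-step N3).  The census of T5-173 … T5-178 reads the
behaviour of a finite place `v` of `K` in `L = K(√d)` off the Legendre symbol of `d` whenever
`4d ∉ v`.  Here the exceptional set `{v ∣ 4d}` is shown to be FINITE (Mathlib's
`Ideal.finite_factors` on the non-zero ideal `(4d)` — `d ≠ 0` because `√d ∉ 𝓞_K`), so that:

* `finite_setOf_four_mul_mem` — `{v : v ∣ 4d}` is finite;
* `exists_finite_census` — for every quadratic `L/K` there are `d ∈ 𝓞_K` and a FINITE set `S` of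
  places of `K` such that at every `v ∉ S`: `v` stays prime in `L` (N3's local «inert»: a unique
  `w ∣ v`, `e = 1`, `f = 2`) ⟺ `d` is not a square mod `v`, and `v` splits ⟺ `d` is a square;
* `exists_finite_census_cm` — the same for every CM field `E` over `E⁺` (the record's setting:
  the inert places of `E⁺` in `E` are determined by one Legendre symbol outside a finite `S` —
  the kernel form of «`S_bad` is finite» for the Galois sorting of the places).

No `sorry`, no axiom beyond `propext`, `Classical.choice`, `Quot.sound`.
-/

namespace Summit.Ventures.HodgeRepro2.T5QuadraticCensusFinite

open NumberField IsDedekindDomain HeightOneSpectrum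

variable {K : Type*} [Field K] [NumberField K] {L : Type*} [Field L] [NumberField L] [Algebra K L]
  {x : 𝓞 L} {d : 𝓞 K}

omit [NumberField K] [NumberField L] in
/-- `d ≠ 0` when `x * x = d` and `x ∉ 𝓞_K`. -/
theorem d_ne_zero (hx : x * x = algebraMap (𝓞 K) (𝓞 L) d)
    (hx' : x ∉ Set.range (algebraMap (𝓞 K) (𝓞 L))) : d ≠ 0 := by
  rintro rfl
  rw [map_zero, mul_self_eq_zero] at hx
  exact hx' ⟨0, by rw [map_zero, hx]⟩

omit [NumberField L] in
/-- `4 * d ≠ 0` (`K` has characteristic `0`). -/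
theorem four_mul_ne_zero (hx : x * x = algebraMap (𝓞 K) (𝓞 L) d)
    (hx' : x ∉ Set.range (algebraMap (𝓞 K) (𝓞 L))) : 4 * d ≠ 0 := by
  intro h
  have h' := congrArg (algebraMap (𝓞 K) K) h
  rw [map_mul, map_ofNat, map_zero, mul_eq_zero] at h'
  rcases h' with h4 | hd
  · exact (by norm_num : (4 : K) ≠ 0) h4
  · exact d_ne_zero hx hx' (FaithfulSMul.algebraMap_injective (𝓞 K) K (by rw [hd, map_zero]))

omit [NumberField L] in
/-- The exceptional set of the census, `{v : 4d ∈ v}`, is finite. -/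
theorem finite_setOf_four_mul_mem (hx : x * x = algebraMap (𝓞 K) (𝓞 L) d)
    (hx' : x ∉ Set.range (algebraMap (𝓞 K) (𝓞 L))) :
    {v : HeightOneSpectrum (𝓞 K) | 4 * d ∈ v.asIdeal}.Finite := by
  have h := Ideal.finite_factors (R := 𝓞 K) (I := Ideal.span {4 * d})
    (by rw [Ne, Ideal.zero_eq_bot, Ideal.span_singleton_eq_bot]; exact four_mul_ne_zero hx hx')
  refine h.subset fun v hv => ?_
  show v.asIdeal ∣ Ideal.span {4 * d}
  rw [Ideal.dvd_iff_le, Ideal.span_singleton_le_iff_mem]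
  exact hv

/-- **The census decides all but finitely many places**: for `[L : K] = 2` there are `d ∈ 𝓞_K` and
a finite set `S` of finite places of `K` such that for every `v ∉ S`, N3's local «inert» (a unique
`w ∣ v` with `e = 1`, `f = 2`), «`v` stays prime» and «`d` is not a square mod `v`» are equivalent,
and `d` a square mod `v` gives two distinct places over `v`. -/
theorem exists_finite_census (h2 : Module.finrank K L = 2) :
    ∃ (d : 𝓞 K) (S : Set (HeightOneSpectrum (𝓞 K))), S.Finite ∧
      ∀ v ∉ S,
        ((∃ w : HeightOneSpectrum (𝓞 L), w.asIdeal.LiesOver v.asIdeal ∧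
            (∀ w' : HeightOneSpectrum (𝓞 L), w'.asIdeal.LiesOver v.asIdeal → w' = w) ∧
            v.asIdeal.ramificationIdx' w.asIdeal = 1 ∧ v.asIdeal.inertiaDeg' w.asIdeal = 2) ↔
          ¬ IsSquare (Ideal.Quotient.mk v.asIdeal d)) ∧
        ((∃ w : HeightOneSpectrum (𝓞 L), v.asIdeal.map (algebraMap (𝓞 K) (𝓞 L)) = w.asIdeal) ↔
          ¬ IsSquare (Ideal.Quotient.mk v.asIdeal d)) ∧
        (IsSquare (Ideal.Quotient.mk v.asIdeal d) →
          ∃ w₁ w₂ : HeightOneSpectrum (𝓞 L), w₁ ≠ w₂ ∧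
            w₁.asIdeal.LiesOver v.asIdeal ∧ w₂.asIdeal.LiesOver v.asIdeal) := by
  obtain ⟨x, d, hx, hx'⟩ := T5QuadraticGenerator.exists_sq_eq_algebraMap h2
  refine ⟨d, {v | 4 * d ∈ v.asIdeal}, finite_setOf_four_mul_mem hx hx', fun v hv => ?_⟩
  have hv' : 4 * d ∉ v.asIdeal := hv
  exact ⟨T5QuadraticInertBridge.unique_unramified_iff_not_isSquare v h2 hx hx' hv',
    T5QuadraticConductor.exists_map_eq_asIdeal_iff_not_isSquare v h2 hx hx' hv',
    T5QuadraticSplitRamified.exists_ne_liesOver_of_isSquare v h2 hx hx' hv'⟩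

/-- The same for a CM field `E` over `E⁺` (Mathlib's `NumberField.IsCMField`): outside a finite
set of places of `E⁺`, «`v` inert in `E`» is one Legendre symbol. -/
theorem exists_finite_census_cm (E : Type*) [Field E] [NumberField E] [IsCMField E] :
    ∃ (d : 𝓞 (maximalRealSubfield E)) (S : Set (HeightOneSpectrum (𝓞 (maximalRealSubfield E)))),
      S.Finite ∧ ∀ v ∉ S,
        ((∃ w : HeightOneSpectrum (𝓞 E), w.asIdeal.LiesOver v.asIdeal ∧
            (∀ w' : HeightOneSpectrum (𝓞 E), w'.asIdeal.LiesOver v.asIdeal → w' = w) ∧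
            v.asIdeal.ramificationIdx' w.asIdeal = 1 ∧ v.asIdeal.inertiaDeg' w.asIdeal = 2) ↔
          ¬ IsSquare (Ideal.Quotient.mk v.asIdeal d)) ∧
        ((∃ w : HeightOneSpectrum (𝓞 E),
            v.asIdeal.map (algebraMap (𝓞 (maximalRealSubfield E)) (𝓞 E)) = w.asIdeal) ↔
          ¬ IsSquare (Ideal.Quotient.mk v.asIdeal d)) ∧
        (IsSquare (Ideal.Quotient.mk v.asIdeal d) →
          ∃ w₁ w₂ : HeightOneSpectrum (𝓞 E), w₁ ≠ w₂ ∧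
            w₁.asIdeal.LiesOver v.asIdeal ∧ w₂.asIdeal.LiesOver v.asIdeal) :=
  exists_finite_census (K := maximalRealSubfield E) (L := E)
    (T5CMInertPlacePackage.finrank_eq_two_cm E)

end Summit.Ventures.HodgeRepro2.T5QuadraticCensusFinite
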